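import Literature.Analysis.FluidPDE.DriftHeatKernelLowerBound
import Literature.Analysis.FluidPDE.ParabolicLocalEstimates
import HarnessLib

/-!
# Proof of Lieberman's local maximum principle (Theorem 6.17) for `uₜ + a·∇u − Δu = 0` by
# Gaussian comparison and absorption

Analysis/FluidPDE proofs file (theorems only): the discharge
`Lieberman1996_local_max_holds` of the named fact
`Literature.Analysis.FluidPDE.Lieberman1996_local_max` of `ParabolicLocalEstimates`
(G. M. Lieberman, *Second Order Parabolic Differential Equations* (1996), Ch. VI §6,
**Theorem 6.17**, the local maximum principle
`sup_{Q(R)} u ≤ C[(R^{-n-2} ∫_{Q(2R)} (u⁺)^m dX)^{1/m} + kR]`, vendored for the linear equation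
`uₜ + a·∇u − Δu = 0` with bounded measurable drift `‖a‖ ≤ A`, `m = 1`, in the elementary
time-integrated solution class of `KNSS2009_lemma21`, one constant `C = C(A, R₀, n)` for all
radii `R ≤ R₀` and all `k > 0`).

The printed proof is Moser's iteration (energy inequality for the test function
`η²χ(u)(u − kR)⁺`, Sobolev inequality, iteration over `q = mκʲ`). Because the principal part
here is the Laplacian and the members of the vendored class are classical in space, this file
gives instead a **comparison proof**, dimension-free and without Sobolev inequalities, on top
of the kernel-barrier machinery of the tree (`DriftHeatKernel`, `DriftHeatKernelBarrier`,
`DriftHeatGaussianBounds`, `DriftHeatLocalComparison`, `DriftHeatKernelLowerBound`):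

* `absorb_of_le_mul_add_div_pow` — the **absorption lemma** of the Giaquinta–Giusti
  iteration: `f(ρ) ≤ θ f(ρ') + K (ρ' − ρ)^{-m}` for all `r₀ ≤ ρ < ρ' ≤ r₁` with `θ < 1` and
  `f ≥ 0` bounded implies `f(r₀) ≤ C(θ, m) K (r₁ − r₀)^{-m}`;
* `exists_driftHeat_ageConstants` — explicit **age constants** `κ, c₀ > 0` (depending on `n`,
  `A`, `R₀`): for `ρ ≤ R₀` and ages `κρ²/2 ≤ σ ≤ 2κρ²` the in-ball lower bound
  `kSubLow n A (ρ/2) σ` of the subsolution kernel beats the Gaussian tail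
  `gaussTail n (3ρ/2) σ` by `c₀ ρ^{-n}`, and `2nσ ≤ (3ρ/2)²` for `σ ≤ 2κρ²`;
* `IsDriftHeatSolutionOn.mass_closedBall_le_of_nonneg` — the **mass-to-point lower bound**
  for a member `v ≥ 0` of the class on `[t − κρ², t] × B̄(x, 2ρ)`:
  `c₀ ρ^{-n} ∫_{B̄(x, ρ/4)} v(τ, ·) ≤ v(t, x)` for `τ ∈ [t − κρ², t − κρ²/2]`
  (`kernel_lower_bound` of `DriftHeatKernelLowerBound` with the weight `η·v(τ, ·)`);
* `IsDriftHeatSolutionOn.le_theta_mul_sup_add_integral` — the **sup-contraction**: if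
  `u ≤ M` (`M ≥ 0`) on `[t − κρ², t] × B̄(x, 2ρ)` then
  `u(t, x) ≤ θ₀ M + (2c₀/κ) ρ^{-n-2} ∫_{[t−κρ², t−κρ²/2] × B̄(x, ρ/4)} u⁺`,
  `θ₀ = max 0 (1 − c₀ 4^{-n} |B(0,1)|) < 1` (the previous bound for `M − u`, averaged in `τ`);
* `Lieberman1996_local_max_holds` — for the target point `(t, x) ∈ Q((y, s), R)` and the
  cylinders `Q_r = [t − r², t] × B̄(x, r) ⊆ Q((y, s), 2R)` (`r ≤ R`), the sup-contraction at
  the points of `Q_r` with `ρ = (r' − r)/2` gives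
  `sup_{Q_r} u⁺ ≤ θ₀ sup_{Q_{r'}} u⁺ + C₁ (r' − r)^{-n-2} ∫_{Q(2R)} u⁺` (`0 ≤ r < r' ≤ R`), and
  absorption yields `u(t, x) ≤ C R^{-n-2} ∫_{Q(2R)} u⁺ ≤ C (R^{-n-2} ∫_{Q(2R)} u⁺ + kR)`.

## References

* G. M. Lieberman, *Second Order Parabolic Differential Equations*, World Scientific (1996),
  Ch. II Cor. 2.5 (comparison); Ch. VI §6, Theorem 6.17 (the statement discharged here; the
  printed proof is by Moser iteration). [Lieberman1996]
* E. Giusti, *Direct Methods in the Calculus of Variations*, World Scientific (2003),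
  Lemma 6.1 (the absorption lemma of the Giaquinta–Giusti iteration; folklore rendering, no
  statement of that book is vendored).
-/

noncomputable section

open MeasureTheory Real Set Filter Metric Function InnerProductSpace
open scoped Topology

namespace Literature.Analysis.FluidPDE

/-! ### The absorption lemma -/

/-- **Absorption lemma** (Giaquinta–Giusti iteration; e.g. Giusti, *Direct methods in the
calculus of variations*, Lemma 6.1; Han–Lin, Lemma 4.3): for `0 ≤ θ < 1` and `m : ℕ` there is
`C = C(θ, m) > 0` such that every `f`, nonnegative and bounded above on `[r₀, r₁]`, with
`f ρ ≤ θ f ρ' + K / (ρ' − ρ)^m` for all `r₀ ≤ ρ < ρ' ≤ r₁` (`K ≥ 0`), satisfies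
`f r₀ ≤ C K / (r₁ − r₀)^m`. [folklore] -/
theorem absorb_of_le_mul_add_div_pow {θ : ℝ} (hθ0 : 0 ≤ θ) (hθ1 : θ < 1) (m : ℕ) :
    ∃ C : ℝ, 0 < C ∧ ∀ (f : ℝ → ℝ) (r₀ r₁ K B : ℝ), r₀ < r₁ → 0 ≤ K →
      (∀ r ∈ Icc r₀ r₁, 0 ≤ f r) → (∀ r ∈ Icc r₀ r₁, f r ≤ B) →
      (∀ ρ ρ', r₀ ≤ ρ → ρ < ρ' → ρ' ≤ r₁ → f ρ ≤ θ * f ρ' + K / (ρ' - ρ) ^ m) →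
      f r₀ ≤ C * K / (r₁ - r₀) ^ m := by
  -- choose `λ ∈ (0, 1)` with `θ < λ ^ m`
  obtain ⟨l, ⟨hl0, hl1⟩, hθl⟩ : ∃ l : ℝ, (0 < l ∧ l < 1) ∧ θ < l ^ m := by
    have h1 : ∀ᶠ l in 𝓝 (1 : ℝ), θ < l ^ m := by
      have hc : Tendsto (fun l : ℝ => l ^ m) (𝓝 1) (𝓝 (1 ^ m)) :=
        (continuous_pow m).tendsto 1
      rw [one_pow] at hc
      exact hc.eventually (lt_mem_nhds hθ1)
    have h2 : ∀ᶠ l in 𝓝 (1 : ℝ), 0 < l := lt_mem_nhds one_pos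
    have h3 : ∀ᶠ l in 𝓝[<] (1 : ℝ), l < 1 := eventually_nhdsWithin_of_forall fun l hl => hl
    obtain ⟨l, hl⟩ := (((h1.and h2).filter_mono nhdsWithin_le_nhds).and h3).exists
    exact ⟨l, ⟨hl.1.2, hl.2⟩, hl.1.1⟩
  have hlm : 0 < l ^ m := pow_pos hl0 m
  set q : ℝ := θ / l ^ m with hq
  have hq0 : 0 ≤ q := div_nonneg hθ0 hlm.le
  have hq1 : q < 1 := (div_lt_one hlm).2 hθl
  have h1l : 0 < 1 - l := by linarith
  refine ⟨1 / ((1 - l) ^ m * (1 - q)), by positivity, ?_⟩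
  intro f r₀ r₁ K B hr hK hf0 hfB hrec
  set d : ℝ := r₁ - r₀ with hd
  have hdpos : 0 < d := by rw [hd]; linarith
  -- the radii `ρ i = r₀ + (1 - l^i) d`
  set ρ : ℕ → ℝ := fun i => r₀ + (1 - l ^ i) * d with hρ
  have hρ_mem : ∀ i, ρ i ∈ Icc r₀ r₁ := by
    intro i
    have h1 : 0 ≤ 1 - l ^ i := sub_nonneg.2 (pow_le_one₀ hl0.le hl1.le)
    have h2 : 1 - l ^ i ≤ 1 := sub_le_self _ (pow_nonneg hl0.le i)
    refine ⟨by simp only [hρ]; nlinarith, ?_⟩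
    simp only [hρ]
    nlinarith
  have hρ_diff : ∀ i, ρ (i + 1) - ρ i = l ^ i * ((1 - l) * d) := by
    intro i; simp only [hρ, pow_succ]; ring
  have hρ_lt : ∀ i, ρ i < ρ (i + 1) := by
    intro i
    have := hρ_diff i
    have h2 : 0 < l ^ i * ((1 - l) * d) := by positivity
    linarith
  -- the unit of the error term
  set K₁ : ℝ := K / ((1 - l) * d) ^ m with hK₁
  have hK₁0 : 0 ≤ K₁ := div_nonneg hK (by positivity)
  -- one step: `θ^i f(ρ i) ≤ θ^(i+1) f(ρ (i+1)) + K₁ q^i`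
  have hstep : ∀ i, θ ^ i * f (ρ i) ≤ θ ^ (i + 1) * f (ρ (i + 1)) + K₁ * q ^ i := by
    intro i
    have h := hrec (ρ i) (ρ (i + 1)) (hρ_mem i).1 (hρ_lt i) (hρ_mem (i + 1)).2
    rw [hρ_diff i, mul_pow, ← pow_mul] at h
    have hθi : 0 ≤ θ ^ i := pow_nonneg hθ0 i
    have hli : 0 < l ^ (i * m) := pow_pos hl0 _
    have e1 : K / (l ^ (i * m) * ((1 - l) * d) ^ m) = K₁ * (l ^ m)⁻¹ ^ i := by
      rw [hK₁, ← inv_pow, ← pow_mul, inv_pow, mul_comm i m]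
      field_simp
    rw [e1] at h
    have e2 : θ ^ i * (K₁ * (l ^ m)⁻¹ ^ i) = K₁ * q ^ i := by
      rw [hq, div_eq_mul_inv, mul_pow]; ring
    calc θ ^ i * f (ρ i) ≤ θ ^ i * (θ * f (ρ (i + 1)) + K₁ * (l ^ m)⁻¹ ^ i) :=
          mul_le_mul_of_nonneg_left h hθi
      _ = θ ^ (i + 1) * f (ρ (i + 1)) + K₁ * q ^ i := by rw [← e2, pow_succ]; ring
  -- iterate: `f r₀ ≤ θ^k f(ρ k) + K₁ Σ_{i<k} q^i`
  have hiter : ∀ k, f r₀ ≤ θ ^ k * f (ρ k) + K₁ * ∑ i ∈ Finset.range k, q ^ i := by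
    intro k
    induction k with
    | zero => simp [hρ]
    | succ k ih =>
      rw [Finset.sum_range_succ, mul_add]
      linarith [hstep k]
  -- bound the geometric sum and let `k → ∞`
  have hgeom : ∀ k, ∑ i ∈ Finset.range k, q ^ i ≤ 1 / (1 - q) := by
    intro k
    have h := (summable_geometric_of_lt_one hq0 hq1).sum_le_tsum (Finset.range k)
      (fun i _ => pow_nonneg hq0 i)
    rw [tsum_geometric_of_lt_one hq0 hq1] at h
    simpa only [one_div] using h
  have hmain : ∀ k, f r₀ ≤ θ ^ k * B + K₁ * (1 / (1 - q)) := by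
    intro k
    have h1 : θ ^ k * f (ρ k) ≤ θ ^ k * B :=
      mul_le_mul_of_nonneg_left (hfB _ (hρ_mem k)) (pow_nonneg hθ0 k)
    have h2 : K₁ * ∑ i ∈ Finset.range k, q ^ i ≤ K₁ * (1 / (1 - q)) :=
      mul_le_mul_of_nonneg_left (hgeom k) hK₁0
    linarith [hiter k]
  have hlim : Tendsto (fun k : ℕ => θ ^ k * B + K₁ * (1 / (1 - q))) atTop
      (𝓝 (0 * B + K₁ * (1 / (1 - q)))) :=
    ((tendsto_pow_atTop_nhds_zero_of_lt_one hθ0 hθ1).mul_const B).add_const _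
  have hle : f r₀ ≤ 0 * B + K₁ * (1 / (1 - q)) :=
    ge_of_tendsto' hlim fun k => hmain k
  rw [zero_mul, zero_add] at hle
  refine hle.trans (le_of_eq ?_)
  rw [hK₁, hd, mul_pow]
  field_simp


/-! ### The age constants -/

/-- `(ρ²)^(-n/2) = (ρ^n)⁻¹` for `ρ ≥ 0`. [folklore] -/
theorem rpow_sq_neg_half_eq_inv_pow {ρ : ℝ} (hρ : 0 ≤ ρ) (n : ℕ) :
    (ρ ^ 2) ^ (-(n : ℝ) / 2) = (ρ ^ n)⁻¹ := by
  rw [show ρ ^ 2 = ρ ^ (2 : ℝ) by norm_cast, ← rpow_mul hρ, neg_div,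
    show (2 : ℝ) * -((n : ℝ) / 2) = -(n : ℝ) by ring, rpow_neg hρ, rpow_natCast]
set_option maxHeartbeats 400000 in -- buildfix (bf3-g27): 160k/180k FAIL, 200k PASS at accept time; line-neutral budget line
/-- **The age constants of the mass-to-point bound.** For a dimension `n`, a drift bound
`A ≥ 0` and a maximal radius `R₀`, there are `κ ∈ (0, 1]` (age fraction) and `c₀ > 0` such
that for `0 < ρ ≤ R₀`: every age `σ ≤ 2κρ²` has `2nσ ≤ (3ρ/2)²` (the Gaussian tail at distance
`3ρ/2` is still increasing), and for `κρ²/2 ≤ σ ≤ 2κρ²` the in-ball lower bound of the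
subsolution kernel at radius `ρ/2` beats the tail at distance `3ρ/2` by `c₀ ρ^{-n}`:
`c₀ ρ^{-n} ≤ kSubLow n A (ρ/2) σ − gaussTail n (3ρ/2) σ`. [folklore] -/
theorem exists_driftHeat_ageConstants (n : ℕ) {A R₀ : ℝ} (hA : 0 ≤ A) (hR₀ : 0 < R₀) :
    ∃ κ c₀ : ℝ, 0 < κ ∧ κ ≤ 1 ∧ 0 < c₀ ∧
      (∀ ⦃ρ σ : ℝ⦄, 0 < σ → σ ≤ 2 * κ * ρ ^ 2 → 2 * (n : ℝ) * σ ≤ (3 * ρ / 2) ^ 2) ∧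
      (∀ ⦃ρ σ : ℝ⦄, 0 < ρ → ρ ≤ R₀ → κ * ρ ^ 2 / 2 ≤ σ → σ ≤ 2 * κ * ρ ^ 2 →
        c₀ * (ρ ^ n)⁻¹ ≤ kSubLow n A (ρ / 2) σ - gaussTail n (3 * ρ / 2) σ) := by
  -- the maximal tilt `T₁` and the age fraction `κ`
  set T₁ : ℝ := A * R₀ * (3 / 2 + 2 * (n + 1)) + 2 * A ^ 2 * R₀ ^ 2 with hT₁
  have hT₁0 : 0 ≤ T₁ := by positivity
  set κ : ℝ := min (1 / (4 * (T₁ + 1))) (1 / (2 * n + 2)) with hκ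
  have hκpos : 0 < κ := lt_min (by positivity) (by positivity)
  have hκT : κ ≤ 1 / (4 * (T₁ + 1)) := min_le_left _ _
  have hκn : κ ≤ 1 / (2 * n + 2) := min_le_right _ _
  have hκhalf : κ ≤ 1 / 2 := hκn.trans (by
    rw [div_le_div_iff₀ (by positivity) (by norm_num)]; nlinarith [n.cast_nonneg (α := ℝ)])
  have hκ1 : κ ≤ 1 := hκhalf.trans (by norm_num)
  set c₀ : ℝ := 1 / 2 * (8 * π * κ) ^ (-(n : ℝ) / 2) * exp (-(1 / (8 * κ)) - T₁) with hc₀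
  have hc₀pos : 0 < c₀ := by positivity
  refine ⟨κ, c₀, hκpos, hκ1, hc₀pos, ?_, ?_⟩
  · -- `2nσ ≤ (3ρ/2)²`
    intro ρ σ hσ hσle
    have hn0 : (0 : ℝ) ≤ n := n.cast_nonneg
    have h1 : κ * (2 * n + 2) ≤ 1 := by
      rw [le_div_iff₀ (by positivity)] at hκn; exact hκn
    have h2 : 2 * (n : ℝ) * σ ≤ 2 * n * (2 * κ * ρ ^ 2) := by nlinarith
    nlinarith [sq_nonneg ρ, mul_nonneg hn0 (sq_nonneg ρ)]
  · -- the lower bound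
    intro ρ σ hρ hρR hσlo hσhi
    have hσ : 0 < σ := lt_of_lt_of_le (by positivity) hσlo
    have hρ2 : 0 < ρ ^ 2 := by positivity
    -- the tilt is at most `T₁`
    have hsqσ : √σ ≤ ρ := by
      rw [sqrt_le_left hρ.le]
      nlinarith
    have hsq1 : √((ρ / 2) ^ 2 + σ) ≤ ρ / 2 + √σ := by
      rw [sqrt_le_left (by positivity)]
      nlinarith [sq_sqrt hσ.le, sqrt_nonneg σ]
    have htilt : dkTilt n A (ρ / 2) σ ≤ T₁ := by
      rw [dkTilt, hT₁]
      have h1 : A * √((ρ / 2) ^ 2 + σ) ≤ A * (3 / 2 * ρ) := by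
        refine mul_le_mul_of_nonneg_left ?_ hA; linarith
      have h2 : 2 * ((n : ℝ) + 1) * A * √σ ≤ 2 * (n + 1) * A * ρ :=
        mul_le_mul_of_nonneg_left hsqσ (by positivity)
      have h3 : 2 * A ^ 2 * σ ≤ 2 * A ^ 2 * R₀ ^ 2 := by
        refine mul_le_mul_of_nonneg_left ?_ (by positivity)
        nlinarith [mul_le_mul hρR hρR hρ.le hR₀.le]
      have h4 : A * (3 / 2 * ρ) + 2 * (n + 1) * A * ρ ≤ A * R₀ * (3 / 2 + 2 * (n + 1)) := by
        have : A * ρ ≤ A * R₀ := mul_le_mul_of_nonneg_left hρR hA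
        nlinarith [n.cast_nonneg (α := ℝ)]
      linarith
    -- `8a ≥ T₁ + 1` for `a = ρ²/(16σ)`
    have h8a : T₁ + 1 ≤ ρ ^ 2 / (2 * σ) := by
      rw [le_div_iff₀ (by positivity)]
      have h1 : κ * (4 * (T₁ + 1)) ≤ 1 := by
        rw [le_div_iff₀ (by positivity)] at hκT; exact hκT
      nlinarith
    -- `2 gaussTail ≤ kSubLow`
    set N : ℝ := (4 * π * σ) ^ (-(n : ℝ) / 2) with hN
    have hNpos : 0 < N := rpow_pos_of_pos (by positivity) _
    have hG : gaussTail n (3 * ρ / 2) σ = N * exp (-(9 * (ρ ^ 2 / (16 * σ)))) := by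
      rw [gaussTail, hN]; congr 1; congr 1; field_simp; ring
    have hK : kSubLow n A (ρ / 2) σ =
        N * exp (-(ρ ^ 2 / (16 * σ))) * exp (-dkTilt n A (ρ / 2) σ) := by
      rw [kSubLow, hN]; congr 1; congr 1; congr 1; field_simp; ring
    have h2le : 2 * gaussTail n (3 * ρ / 2) σ ≤ kSubLow n A (ρ / 2) σ := by
      rw [hG, hK]
      have key : 2 * exp (-(9 * (ρ ^ 2 / (16 * σ)))) ≤
          exp (-(ρ ^ 2 / (16 * σ))) * exp (-dkTilt n A (ρ / 2) σ) := by
        rw [← exp_add]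
        have h1 : (2 : ℝ) ≤ exp 1 := by linarith [add_one_le_exp (1 : ℝ)]
        have h2 : exp 1 * exp (-(9 * (ρ ^ 2 / (16 * σ)))) ≤
            exp (-(ρ ^ 2 / (16 * σ)) + -dkTilt n A (ρ / 2) σ) := by
          rw [← exp_add, exp_le_exp]
          have : ρ ^ 2 / (2 * σ) = 8 * (ρ ^ 2 / (16 * σ)) := by field_simp; ring
          linarith
        calc 2 * exp (-(9 * (ρ ^ 2 / (16 * σ)))) ≤ exp 1 * exp (-(9 * (ρ ^ 2 / (16 * σ)))) :=
            mul_le_mul_of_nonneg_right h1 (exp_pos _).le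
          _ ≤ _ := h2
      calc 2 * (N * exp (-(9 * (ρ ^ 2 / (16 * σ)))))
          = N * (2 * exp (-(9 * (ρ ^ 2 / (16 * σ))))) := by ring
        _ ≤ N * (exp (-(ρ ^ 2 / (16 * σ))) * exp (-dkTilt n A (ρ / 2) σ)) :=
            mul_le_mul_of_nonneg_left key hNpos.le
        _ = _ := by ring
    -- `kSubLow/2 ≥ c₀ ρ^{-n}`
    have hNlow : (8 * π * κ) ^ (-(n : ℝ) / 2) * (ρ ^ n)⁻¹ ≤ N := by
      rw [hN, ← rpow_sq_neg_half_eq_inv_pow hρ.le n, ← mul_rpow (by positivity) hρ2.le]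
      have hxy : 4 * π * σ ≤ 8 * π * κ * ρ ^ 2 :=
        calc 4 * π * σ = 4 * (π * σ) := by ring
          _ ≤ 4 * (π * (2 * κ * ρ ^ 2)) := by gcongr
          _ = 8 * π * κ * ρ ^ 2 := by ring
      have hz : -(n : ℝ) / 2 ≤ 0 := by
        have : (0 : ℝ) ≤ n := n.cast_nonneg
        linarith
      exact rpow_le_rpow_of_nonpos (by positivity) hxy hz
    have hElow : exp (-(1 / (8 * κ)) - T₁) ≤
        exp (-(ρ ^ 2 / (16 * σ))) * exp (-dkTilt n A (ρ / 2) σ) := by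
      rw [← exp_add, exp_le_exp]
      have h1 : ρ ^ 2 / (16 * σ) ≤ 1 / (8 * κ) := by
        rw [div_le_div_iff₀ (by positivity) (by positivity)]
        have h3 : κ * ρ ^ 2 ≤ 2 * σ := by linarith [hσlo]
        linarith [h3]
      linarith
    have h5 : (8 * π * κ) ^ (-(n : ℝ) / 2) * (ρ ^ n)⁻¹ * exp (-(1 / (8 * κ)) - T₁) ≤
        N * (exp (-(ρ ^ 2 / (16 * σ))) * exp (-dkTilt n A (ρ / 2) σ)) :=
      mul_le_mul hNlow hElow (exp_pos _).le hNpos.le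
    have h6 : c₀ * (ρ ^ n)⁻¹ =
        1 / 2 * ((8 * π * κ) ^ (-(n : ℝ) / 2) * (ρ ^ n)⁻¹ * exp (-(1 / (8 * κ)) - T₁)) := by
      simp only [hc₀]; ring
    rw [h6]
    rw [hK] at h2le ⊢
    linarith

/-! ### Mass-to-point lower bound for nonnegative solutions -/

section Solutions

variable {E : Type*} [NormedAddCommGroup E] [InnerProductSpace ℝ E] [FiniteDimensional ℝ E]
  [MeasurableSpace E] [BorelSpace E]

omit [InnerProductSpace ℝ E] [FiniteDimensional ℝ E] [MeasurableSpace E] [BorelSpace E] in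
/-- A continuous cut-off whose topological support lies inside an open set, times a function
continuous on that set, is continuous everywhere. [folklore] -/
theorem continuous_bump_mul_of_continuousOn {U : Set E} (hU : IsOpen U) {η f : E → ℝ}
    (hη : Continuous η) (hηU : tsupport η ⊆ U) (hf : ContinuousOn f U) :
    Continuous fun z => η z * f z := by
  rw [continuous_iff_continuousAt]
  intro z
  by_cases hz : z ∈ U
  · exact hη.continuousAt.mul (hf.continuousAt (hU.mem_nhds hz))
  · have hz' : z ∉ tsupport η := fun h' => hz (hηU h')
    have h0 : (fun w => η w * f w) =ᶠ[𝓝 z] fun _ => (0 : ℝ) := by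
      filter_upwards [(isClosed_tsupport η).isOpen_compl.mem_nhds hz'] with w hw
      simp [image_eq_zero_of_notMem_tsupport hw]
    exact h0.continuousAt

namespace IsDriftHeatSolutionOn

variable {a : ℝ → E → E} {v : ℝ → E → ℝ} {A : ℝ} {S : Set ℝ} {U : Set E}

/-- **Mass-to-point lower bound for nonnegative solutions of `v_t + a·∇v − Δv = 0`** (the
comparison substitute for the weak Harnack inequality in the proof of Theorem 6.17). Let
`κ, c₀ ≥ 0` be age constants in the sense of `exists_driftHeat_ageConstants` (ages
`σ ≤ 2κρ²` satisfy `2nσ ≤ (3ρ/2)²`, and `c₀ρ^{-n} ≤ kSubLow(ρ/2, σ) − gaussTail(3ρ/2, σ)` for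
`κρ²/2 ≤ σ ≤ 2κρ²`, `ρ ≤ R₀`). If `v` is a member of the local class, nonnegative on
`[t − κρ², t] × B̄(x, 2ρ) ⊆ S × U`, `0 < ρ ≤ R₀`, then for every `τ ∈ [t − κρ², t − κρ²/2]`:
`c₀ ρ^{-n} ∫_{B̄(x, ρ/4)} v(τ, z) dz ≤ v(t, x)`. Proof: the Gaussian lower bound
`kernel_lower_bound` (comparison with the kernel barrier `k₋ ⋆ h` on `[τ, t] × B̄(x, 2ρ)`) for
the weight `h = η · v(τ, ·)`, `η` a bump `= 1` on `B̄(x, ρ/4)` supported in `B̄(x, ρ/2)`, at the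
centre `x` and age `t − τ ∈ [κρ²/2, κρ²]`. [folklore] -/
theorem mass_closedBall_le_of_nonneg (hv : IsDriftHeatSolutionOn a v A S U) (hU : IsOpen U)
    {κ c₀ R₀ : ℝ} (hκ : 0 < κ) (hc₀ : 0 ≤ c₀)
    (hage : ∀ ⦃ρ σ : ℝ⦄, 0 < σ → σ ≤ 2 * κ * ρ ^ 2 →
      2 * (Module.finrank ℝ E : ℝ) * σ ≤ (3 * ρ / 2) ^ 2)
    (hlow : ∀ ⦃ρ σ : ℝ⦄, 0 < ρ → ρ ≤ R₀ → κ * ρ ^ 2 / 2 ≤ σ → σ ≤ 2 * κ * ρ ^ 2 →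
      c₀ * (ρ ^ Module.finrank ℝ E)⁻¹ ≤
        kSubLow (Module.finrank ℝ E) A (ρ / 2) σ - gaussTail (Module.finrank ℝ E) (3 * ρ / 2) σ)
    {x : E} {t ρ τ : ℝ} (hρ : 0 < ρ) (hρR : ρ ≤ R₀) (hB : closedBall x (2 * ρ) ⊆ U)
    (hS : Icc (t - κ * ρ ^ 2) t ⊆ S) (hτ1 : t - κ * ρ ^ 2 ≤ τ) (hτ2 : τ ≤ t - κ * ρ ^ 2 / 2)
    (hpos : ∀ r ∈ Icc (t - κ * ρ ^ 2) t, ∀ ξ ∈ closedBall x (2 * ρ), 0 ≤ v r ξ) :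
    c₀ * (ρ ^ Module.finrank ℝ E)⁻¹ * ∫ z in closedBall x (ρ / 4), v τ z ≤ v t x := by
  have hκρ : 0 < κ * ρ ^ 2 := by positivity
  have hτt : τ < t := by linarith
  have htS : t ∈ S := hS ⟨by linarith, le_rfl⟩
  have hxU : x ∈ U := hB (mem_closedBall_self (by positivity))
  have hA : 0 ≤ A := hv.drift_bound_nonneg htS hxU
  have hτI : τ ∈ Icc (t - κ * ρ ^ 2) t := ⟨hτ1, by linarith⟩
  have hIcc : Icc τ t ⊆ Icc (t - κ * ρ ^ 2) t := Icc_subset_Icc hτ1 le_rfl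
  have hS' : Icc τ t ⊆ S := hIcc.trans hS
  -- the cut-off `η` and the weight `h = η · v(τ, ·)`
  let η : ContDiffBump x := ⟨ρ / 4, ρ / 2, by positivity, by linarith⟩
  have hηts : tsupport (η : E → ℝ) ⊆ U := by
    rw [η.tsupport_eq]
    exact (closedBall_subset_closedBall (by show ρ / 2 ≤ 2 * ρ; linarith)).trans hB
  have hη0 : ∀ z, ρ / 2 ≤ dist z x → η z = 0 := fun z hz => η.zero_of_le_dist hz
  set h : E → ℝ := fun z => η z * v τ z with hh_def
  have hvc : ContinuousOn (v τ) U := (hv.contDiffOn τ (hS' ⟨le_rfl, hτt.le⟩)).continuousOn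
  have hh : Continuous h := continuous_bump_mul_of_continuousOn hU η.continuous hηts hvc
  have hts : tsupport h ⊆ closedBall x (ρ / 2) := by
    refine (tsupport_mul_subset_left (f := (η : E → ℝ)) (g := v τ)).trans ?_
    rw [η.tsupport_eq]
  have h0 : ∀ z, 0 ≤ h z := by
    intro z
    by_cases hz : dist z x < ρ / 2
    · exact mul_nonneg η.nonneg (hpos τ hτI z (mem_closedBall.2 (by linarith)))
    · simp [hh_def, hη0 z (not_lt.1 hz)]
  have hle_v : ∀ z ∈ closedBall x (2 * ρ), h z ≤ v τ z := fun z hz =>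
    mul_le_of_le_one_left (hpos τ hτI z hz) η.le_one
  have heq_v : ∀ z ∈ closedBall x (ρ / 4), h z = v τ z := fun z hz => by
    simp [hh_def, η.one_of_mem_closedBall hz]
  have hint_h : Integrable h :=
    hh.integrable_of_hasCompactSupport (hasCompactSupport_mul_lambda η.hasCompactSupport)
  have hm0 : 0 ≤ ∫ z, h z := integral_nonneg h0
  -- `∫_{B̄(x, ρ/4)} v(τ, ·) ≤ ∫ h`
  have hmass : ∫ z in closedBall x (ρ / 4), v τ z ≤ ∫ z, h z :=
    calc ∫ z in closedBall x (ρ / 4), v τ z = ∫ z in closedBall x (ρ / 4), h z :=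
        (setIntegral_congr_fun measurableSet_closedBall heq_v).symm
      _ ≤ ∫ z, h z := setIntegral_le_integral hint_h (Eventually.of_forall h0)
  -- the Gaussian lower bound at the centre, age `t - τ`
  have hroom : 2 * (Module.finrank ℝ E : ℝ) * (t - τ) < (2 * ρ - ρ / 2) ^ 2 := by
    have h1 := hage (by linarith : 0 < 2 * (t - τ)) (by linarith : 2 * (t - τ) ≤ 2 * κ * ρ ^ 2)
    have h2 : (0 : ℝ) < (3 * ρ / 2) ^ 2 := by positivity
    have h3 : 0 ≤ 2 * (Module.finrank ℝ E : ℝ) * (t - τ) := by positivity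
    nlinarith
  have hsph : ∀ r ∈ Icc τ t, ∀ ξ : E, ‖ξ - x‖ = 2 * ρ → 0 ≤ v r ξ := fun r hr ξ hξ =>
    hpos r (hIcc hr) ξ (mem_closedBall.2 (by rw [dist_eq_norm]; exact hξ.le))
  have hklb := hv.kernel_lower_bound hU hA (c := x) (re := 0) (by positivity : 0 < ρ / 2)
    (by linarith : ρ / 2 < 2 * ρ) (by linarith) hS' hB hroom hsph hh h0 hts hle_v t
    ⟨hτt, le_rfl⟩ x (mem_closedBall_self le_rfl)
  rw [zero_add, show 2 * ρ - ρ / 2 = 3 * ρ / 2 by ring] at hklb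
  have hgap := hlow hρ hρR (by linarith : κ * ρ ^ 2 / 2 ≤ t - τ) (by linarith)
  calc c₀ * (ρ ^ Module.finrank ℝ E)⁻¹ * ∫ z in closedBall x (ρ / 4), v τ z
      ≤ c₀ * (ρ ^ Module.finrank ℝ E)⁻¹ * ∫ z, h z :=
        mul_le_mul_of_nonneg_left hmass (by positivity)
    _ ≤ (∫ z, h z) * (kSubLow (Module.finrank ℝ E) A (ρ / 2) (t - τ) -
          gaussTail (Module.finrank ℝ E) (3 * ρ / 2) (t - τ)) := by
        rw [mul_comm]; exact mul_le_mul_of_nonneg_left hgap hm0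
    _ ≤ v t x := hklb

end IsDriftHeatSolutionOn

/-! ### The sup-contraction -/

namespace IsDriftHeatSolutionOn

variable {a : ℝ → E → E} {u : ℝ → E → ℝ} {A : ℝ} {S : Set ℝ} {U : Set E}

/-- **Sup-contraction** (the step that replaces Moser's iteration): with age constants `κ, c₀`
as in `exists_driftHeat_ageConstants`, if a member `u` of the local class satisfies `u ≤ M`
(`M ≥ 0`) on `[t − κρ², t] × B̄(x, 2ρ) ⊆ S × U`, `ρ ≤ R₀`, then
`u(t, x) ≤ θ₀ M + (2c₀/κ) ρ^{-n-2} ∫_{[t−κρ², t−κρ²/2] × B̄(x, ρ/4)} u⁺`,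
`θ₀ = max 0 (1 − c₀ 4^{-n} |B(0, 1)|) < 1`: apply the mass-to-point bound
`mass_closedBall_le_of_nonneg` to the nonnegative solution `M − u` at every
`τ ∈ [t − κρ², t − κρ²/2]` and average over `τ`. [folklore] -/
theorem le_theta_mul_sup_add_integral (hu : IsDriftHeatSolutionOn a u A S U) (hU : IsOpen U)
    {κ c₀ R₀ : ℝ} (hκ : 0 < κ) (hc₀ : 0 ≤ c₀)
    (hage : ∀ ⦃ρ σ : ℝ⦄, 0 < σ → σ ≤ 2 * κ * ρ ^ 2 →
      2 * (Module.finrank ℝ E : ℝ) * σ ≤ (3 * ρ / 2) ^ 2)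
    (hlow : ∀ ⦃ρ σ : ℝ⦄, 0 < ρ → ρ ≤ R₀ → κ * ρ ^ 2 / 2 ≤ σ → σ ≤ 2 * κ * ρ ^ 2 →
      c₀ * (ρ ^ Module.finrank ℝ E)⁻¹ ≤
        kSubLow (Module.finrank ℝ E) A (ρ / 2) σ - gaussTail (Module.finrank ℝ E) (3 * ρ / 2) σ)
    {x : E} {t ρ M : ℝ} (hρ : 0 < ρ) (hρR : ρ ≤ R₀) (hB : closedBall x (2 * ρ) ⊆ U)
    (hS : Icc (t - κ * ρ ^ 2) t ⊆ S) (hM0 : 0 ≤ M)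
    (hM : ∀ r ∈ Icc (t - κ * ρ ^ 2) t, ∀ ξ ∈ closedBall x (2 * ρ), u r ξ ≤ M) :
    u t x ≤ max 0 (1 - c₀ * (4 ^ Module.finrank ℝ E)⁻¹ * volume.real (ball (0 : E) 1)) * M +
      2 * c₀ / κ * (ρ ^ (Module.finrank ℝ E + 2))⁻¹ *
        ∫ p in Icc (t - κ * ρ ^ 2) (t - κ * ρ ^ 2 / 2) ×ˢ closedBall x (ρ / 4),
          max (u p.1 p.2) 0 := by
  have hκρ : 0 < κ * ρ ^ 2 := by positivity
  -- the nonnegative solution `M - u` on `[t - κρ², t] × U`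
  have hv : IsDriftHeatSolutionOn a (fun r z => -u r z + M) A (Icc (t - κ * ρ ^ 2) t) U :=
    (hu.mono hS Subset.rfl).neg.add_const hU ordConnected_Icc M
  have hvpos : ∀ r ∈ Icc (t - κ * ρ ^ 2) t, ∀ ξ ∈ closedBall x (2 * ρ), 0 ≤ -u r ξ + M :=
    fun r hr ξ hξ => by linarith [hM r hr ξ hξ]
  -- the integration sets
  set J : Set ℝ := Icc (t - κ * ρ ^ 2) (t - κ * ρ ^ 2 / 2) with hJ
  set Bq : Set E := closedBall x (ρ / 4) with hBq
  have hJsub : J ⊆ Icc (t - κ * ρ ^ 2) t := Icc_subset_Icc le_rfl (by linarith)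
  have hBqU : Bq ⊆ U := (closedBall_subset_closedBall (by linarith)).trans hB
  -- continuity and integrability of `u⁺` on `J × Bq`
  have hcont : ContinuousOn (uncurry u) (Icc (t - κ * ρ ^ 2) t ×ˢ U) :=
    hu.continuousOn_uncurry hU hS
  have hFc : ContinuousOn (fun p : ℝ × E => max (u p.1 p.2) 0) (J ×ˢ Bq) :=
    (hcont.mono (prod_mono hJsub hBqU)).sup continuousOn_const
  have hK : IsCompact (J ×ˢ Bq) := isCompact_Icc.prod (isCompact_closedBall _ _)
  have hint : IntegrableOn (fun p : ℝ × E => max (u p.1 p.2) 0) (J ×ˢ Bq) volume :=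
    hFc.integrableOn_compact hK
  have hW0 : 0 ≤ ∫ p in J ×ˢ Bq, max (u p.1 p.2) 0 :=
    setIntegral_nonneg (measurableSet_Icc.prod measurableSet_closedBall) fun p _ => le_max_right _ _
  -- volumes
  set V₁ : ℝ := volume.real (ball (0 : E) 1) with hV₁
  have hVBq : volume.real Bq = (ρ / 4) ^ Module.finrank ℝ E * V₁ :=
    Measure.addHaar_real_closedBall volume x (by positivity)
  have hJvol : volume.real J = κ * ρ ^ 2 / 2 := by
    rw [hJ, volume_real_Icc_of_le (by linarith)]; ring
  -- for each `τ ∈ J`: the pointwise bound from the mass-to-point inequality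
  have hstep : ∀ τ ∈ J,
      u t x - max 0 (1 - c₀ * (4 ^ Module.finrank ℝ E)⁻¹ * V₁) * M ≤
        c₀ * (ρ ^ Module.finrank ℝ E)⁻¹ * ∫ z in Bq, max (u τ z) 0 := by
    intro τ hτ
    have hτS : τ ∈ Icc (t - κ * ρ ^ 2) t := hJsub hτ
    have hmp := hv.mass_closedBall_le_of_nonneg hU hκ hc₀ hage hlow hρ hρR hB Subset.rfl
      hτ.1 hτ.2 hvpos
    have huc : ContinuousOn (u τ) U := (hu.contDiffOn τ (hS hτS)).continuousOn
    have hiu : IntegrableOn (u τ) Bq volume :=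
      (huc.mono hBqU).integrableOn_compact (isCompact_closedBall _ _)
    have hiu' : IntegrableOn (fun z => max (u τ z) 0) Bq volume :=
      ((huc.mono hBqU).sup continuousOn_const).integrableOn_compact (isCompact_closedBall _ _)
    have h1 : ∫ z in Bq, (-u τ z + M) =
        -(∫ z in Bq, u τ z) + (ρ / 4) ^ Module.finrank ℝ E * V₁ * M := by
      have hneg : Integrable (fun z => -u τ z) (volume.restrict Bq) := hiu.neg
      have hcst : Integrable (fun _ : E => M) (volume.restrict Bq) :=
        integrableOn_const (measure_closedBall_lt_top).ne
      rw [integral_add hneg hcst, integral_neg, setIntegral_const, hVBq, smul_eq_mul]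
    have h2 : ∫ z in Bq, u τ z ≤ ∫ z in Bq, max (u τ z) 0 :=
      setIntegral_mono hiu hiu' fun z => le_max_left _ _
    have h3 : c₀ * (ρ ^ Module.finrank ℝ E)⁻¹ * ((ρ / 4) ^ Module.finrank ℝ E * V₁ * M) =
        c₀ * (4 ^ Module.finrank ℝ E)⁻¹ * V₁ * M := by
      rw [div_pow]; field_simp
    have h4 : (1 - c₀ * (4 ^ Module.finrank ℝ E)⁻¹ * V₁) * M ≤
        max 0 (1 - c₀ * (4 ^ Module.finrank ℝ E)⁻¹ * V₁) * M :=
      mul_le_mul_of_nonneg_right (le_max_right _ _) hM0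
    have h5 := mul_le_mul_of_nonneg_left h2 (by positivity : 0 ≤ c₀ * (ρ ^ Module.finrank ℝ E)⁻¹)
    have hmp' : c₀ * (ρ ^ Module.finrank ℝ E)⁻¹ *
        (-(∫ z in Bq, u τ z) + (ρ / 4) ^ Module.finrank ℝ E * V₁ * M) ≤ -u t x + M := by
      rw [← h1]; exact hmp
    linarith [hmp', h3, h4, h5]
  -- integrate over `τ ∈ J`
  have hgi : IntegrableOn (fun τ => ∫ z in Bq, max (u τ z) 0) J volume := by
    have h1 := hint
    rw [IntegrableOn, Measure.volume_eq_prod, ← Measure.prod_restrict] at h1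
    exact h1.integral_prod_left
  have hprod : ∫ p in J ×ˢ Bq, max (u p.1 p.2) 0 = ∫ τ in J, ∫ z in Bq, max (u τ z) 0 := by
    have h1 := hint
    rw [IntegrableOn, Measure.volume_eq_prod] at h1
    rw [Measure.volume_eq_prod, setIntegral_prod _ h1]
  have hmono := setIntegral_mono_on
    (integrableOn_const (by rw [Real.volume_Icc]; exact ENNReal.ofReal_ne_top))
    (hgi.const_mul (c₀ * (ρ ^ Module.finrank ℝ E)⁻¹)) measurableSet_Icc hstep
  rw [setIntegral_const, integral_const_mul, hJvol, smul_eq_mul, ← hprod] at hmono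
  -- algebra
  have hid : κ * ρ ^ 2 / 2 * (2 * c₀ / κ * (ρ ^ (Module.finrank ℝ E + 2))⁻¹ *
      ∫ p in J ×ˢ Bq, max (u p.1 p.2) 0) =
      c₀ * (ρ ^ Module.finrank ℝ E)⁻¹ * ∫ p in J ×ˢ Bq, max (u p.1 p.2) 0 := by
    rw [pow_add]; field_simp
  have hkey : u t x - max 0 (1 - c₀ * (4 ^ Module.finrank ℝ E)⁻¹ * V₁) * M ≤
      2 * c₀ / κ * (ρ ^ (Module.finrank ℝ E + 2))⁻¹ * ∫ p in J ×ˢ Bq, max (u p.1 p.2) 0 := by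
    refine le_of_mul_le_mul_left ?_ (half_pos hκρ)
    rw [show κ * ρ ^ 2 / 2 = κ * ρ ^ 2 / 2 from rfl, hid]
    exact hmono
  linarith

end IsDriftHeatSolutionOn

/-! ### The discharge of Lieberman's Theorem 6.17 for the drift–heat class -/

variable (E) in
set_option maxHeartbeats 400000 in
/-- **Discharge of `Lieberman1996_local_max`** (Lieberman 1996, Ch. VI, Theorem 6.17, for
`uₜ + a·∇u − Δu = 0` with bounded measurable drift, `m = 1`). The printed proof is Moser's
iteration; this proof is by comparison: the sup-contraction `le_theta_mul_sup_add_integral` on the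
cylinders `Q_r = [t − r², t] × B̄(x, r)` around the target point gives
`sup_{Q_r} u⁺ ≤ θ₀ sup_{Q_{r'}} u⁺ + C₁ (r' − r)^{-n-2} ∫_{Q(2R)} u⁺` (`0 ≤ r < r' ≤ R`,
`θ₀ < 1`), and the absorption lemma `absorb_of_le_mul_add_div_pow` yields
`u(t, x) ≤ C R^{-n-2} ∫_{Q(2R)} u⁺ ≤ C (R^{-n-2} ∫_{Q(2R)} u⁺ + kR)`.
[cite: Lieberman1996, Ch. VI Thm 6.17] -/
theorem Lieberman1996_local_max_holds : Lieberman1996_local_max E := by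
  intro A R₀ hR₀
  -- the constants
  set A' : ℝ := max A 0 with hA'
  have hA'0 : 0 ≤ A' := le_max_right _ _
  obtain ⟨κ, c₀, hκ, hκ1, hc₀, hage, hlow⟩ :=
    exists_driftHeat_ageConstants (Module.finrank ℝ E) hA'0 hR₀
  set V₁ : ℝ := volume.real (ball (0 : E) 1) with hV₁
  have hV₁0 : 0 < V₁ :=
    ENNReal.toReal_pos (measure_ball_pos volume _ one_pos).ne' measure_ball_lt_top.ne
  set θ₀ : ℝ := max 0 (1 - c₀ * (4 ^ Module.finrank ℝ E)⁻¹ * V₁) with hθ₀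
  have hθ₀0 : 0 ≤ θ₀ := le_max_left _ _
  have hθ₀1 : θ₀ < 1 := by
    refine max_lt one_pos ?_
    have : 0 < c₀ * (4 ^ Module.finrank ℝ E)⁻¹ * V₁ := by positivity
    linarith
  obtain ⟨Ca, hCa, habs⟩ := absorb_of_le_mul_add_div_pow hθ₀0 hθ₀1 (Module.finrank ℝ E + 2)
  set C₁ : ℝ := 2 * c₀ / κ * 2 ^ (Module.finrank ℝ E + 2) with hC₁
  have hC₁0 : 0 < C₁ := by positivity
  refine ⟨Ca * C₁, by positivity, ?_⟩
  intro Ω T a u hΩ ham haA hu2 hDu hΔu hequ y s R k hR hRR₀ hk hBΩ hs hsT t x ht hx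
  -- the class with drift bound `A' = max A 0`
  have hcl : IsDriftHeatSolutionOn a u A' (Ioc 0 T) Ω :=
    { measurable_drift := ham
      norm_drift_le := fun r hr z hz => (haA r hr z hz).trans (le_max_left _ _)
      contDiffOn := hu2
      continuousOn_fderiv := hDu
      continuousOn_laplacian := hΔu
      integral_eq := fun z hz r hr r' hr' hrr' => hequ z hz r r' hr.1 hrr' hr'.2 }
  -- geometry of the data
  have hR2 : 0 < R ^ 2 := by positivity
  have hxy : dist x y < R := mem_ball.1 hx
  have h4R : (2 * R) ^ 2 = 4 * R ^ 2 := by ring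
  -- `u⁺` is integrable on `Q(2R)`; the integral `I`
  set F : ℝ × E → ℝ := fun p => max (u p.1 p.2) 0 with hF
  set I : ℝ := ∫ p in Ioo (s - (2 * R) ^ 2) s ×ˢ ball y (2 * R), F p with hI
  have hbigS : Icc (s - (2 * R) ^ 2) s ⊆ Ioc 0 T := fun r hr => ⟨by linarith [hr.1], hr.2.trans hsT⟩
  have hcontQ : ContinuousOn (uncurry u) (Icc (s - (2 * R) ^ 2) s ×ˢ Ω) :=
    hcl.continuousOn_uncurry hΩ hbigS
  have hFc : ContinuousOn F (Icc (s - (2 * R) ^ 2) s ×ˢ Ω) := hcontQ.sup continuousOn_const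
  have hintQ : IntegrableOn F (Ioo (s - (2 * R) ^ 2) s ×ˢ ball y (2 * R)) volume :=
    ((hFc.mono (prod_mono Subset.rfl hBΩ)).integrableOn_compact
      (isCompact_Icc.prod (isCompact_closedBall _ _))).mono_set
      (prod_mono Ioo_subset_Icc_self ball_subset_closedBall)
  have hI0 : 0 ≤ I :=
    setIntegral_nonneg (measurableSet_Ioo.prod measurableSet_ball) fun p _ => le_max_right _ _
  have hF0 : ∀ p, 0 ≤ F p := fun p => le_max_right _ _
  -- the cylinders `Q_r = [t - r², t] × B̄(x, r)` and `f r = sup_{Q_r} u⁺`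
  set Q : ℝ → Set (ℝ × E) := fun r => Icc (t - r ^ 2) t ×ˢ closedBall x r with hQ
  set f : ℝ → ℝ := fun r => sSup (F '' Q r) with hf
  have hQsub : ∀ r ∈ Icc 0 R, Q r ⊆ Icc (s - (2 * R) ^ 2) s ×ˢ Ω := by
    intro r hr
    refine prod_mono (Icc_subset_Icc (by nlinarith [ht.1, hr.1, hr.2]) ht.2.le) ?_
    refine ((closedBall_subset_ball' ?_).trans ball_subset_closedBall).trans hBΩ
    linarith [hr.2]
  have hQc : ∀ r, IsCompact (Q r) := fun r => isCompact_Icc.prod (isCompact_closedBall _ _)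
  have hQmono : ∀ r r', 0 ≤ r → r ≤ r' → Q r ⊆ Q r' := fun r r' hr hrr' =>
    prod_mono (Icc_subset_Icc (by nlinarith) le_rfl) (closedBall_subset_closedBall hrr')
  have hbdd : ∀ r ∈ Icc 0 R, BddAbove (F '' Q r) := fun r hr =>
    (hQc r).bddAbove_image (hFc.mono (hQsub r hr))
  have hmemQ : ∀ r, 0 ≤ r → (t, x) ∈ Q r := fun r hr =>
    ⟨⟨by nlinarith, le_rfl⟩, mem_closedBall_self hr⟩
  have hne : ∀ r, 0 ≤ r → (F '' Q r).Nonempty := fun r hr => ⟨_, mem_image_of_mem F (hmemQ r hr)⟩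
  have hFle : ∀ r ∈ Icc 0 R, ∀ p ∈ Q r, F p ≤ f r := fun r hr p hp =>
    le_csSup (hbdd r hr) (mem_image_of_mem F hp)
  have hf0 : ∀ r ∈ Icc 0 R, 0 ≤ f r := fun r hr => (hF0 _).trans (hFle r hr _ (hmemQ r hr.1))
  have hfmono : ∀ r ∈ Icc 0 R, f r ≤ f R := fun r hr =>
    csSup_le_csSup (hbdd R ⟨hR.le, le_rfl⟩) (hne r hr.1) (image_mono (hQmono r R hr.1 hr.2))
  -- the recurrence `f r ≤ θ₀ f r' + C₁ I / (r' - r)^(n+2)`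
  have hrec : ∀ r r', 0 ≤ r → r < r' → r' ≤ R →
      f r ≤ θ₀ * f r' + C₁ * I / (r' - r) ^ (Module.finrank ℝ E + 2) := by
    intro r r' hr hrr' hr'R
    have hr'I : r' ∈ Icc 0 R := ⟨hr.trans hrr'.le, hr'R⟩
    have hrI : r ∈ Icc 0 R := ⟨hr, hrr'.le.trans hr'R⟩
    set ρ : ℝ := (r' - r) / 2 with hρ_def
    have hρ : 0 < ρ := by rw [hρ_def]; linarith
    have hρR₀ : ρ ≤ R₀ := by rw [hρ_def]; linarith
    have hκρ : κ * ρ ^ 2 ≤ 4 * ρ ^ 2 := by nlinarith [sq_nonneg ρ]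
    have hrhs0 : 0 ≤ θ₀ * f r' + C₁ * I / (r' - r) ^ (Module.finrank ℝ E + 2) := by
      have := hf0 r' hr'I
      have : 0 < r' - r := by linarith
      positivity
    refine csSup_le (hne r hr) ?_
    rintro _ ⟨⟨t', x'⟩, ⟨ht', hx'⟩, rfl⟩
    rw [mem_closedBall] at hx'
    -- the region of the sup-contraction around `(t', x')` lies in `Q r'`
    have htime : ∀ r₁ ∈ Icc (t' - κ * ρ ^ 2) t', r₁ ∈ Icc (t - r' ^ 2) t := by
      intro r₁ hr₁
      refine ⟨?_, hr₁.2.trans ht'.2⟩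
      have : r ^ 2 + 4 * ρ ^ 2 ≤ r' ^ 2 := by rw [hρ_def]; nlinarith
      linarith [hr₁.1, ht'.1]
    have hspace : closedBall x' (2 * ρ) ⊆ closedBall x r' :=
      closedBall_subset_closedBall' (by rw [hρ_def]; linarith)
    have hBΩ' : closedBall x' (2 * ρ) ⊆ Ω := by
      refine (hspace.trans ?_).trans hBΩ
      exact (closedBall_subset_ball' (by linarith)).trans ball_subset_closedBall
    have hS' : Icc (t' - κ * ρ ^ 2) t' ⊆ Ioc 0 T := fun r₁ hr₁ =>
      hbigS ((hQsub r' hr'I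
        (show (r₁, x) ∈ Q r' from ⟨htime r₁ hr₁, mem_closedBall_self hr'I.1⟩)).1)
    have hM : ∀ r₁ ∈ Icc (t' - κ * ρ ^ 2) t', ∀ ξ ∈ closedBall x' (2 * ρ), u r₁ ξ ≤ f r' :=
      fun r₁ hr₁ ξ hξ => (le_max_left _ _).trans (hFle r' hr'I (r₁, ξ) ⟨htime r₁ hr₁, hspace hξ⟩)
    have hstep := hcl.le_theta_mul_sup_add_integral hΩ hκ hc₀.le hage hlow hρ hρR₀ hBΩ' hS'
      (hf0 r' hr'I) hM
    -- the small integral is at most `I`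
    have hsub : Icc (t' - κ * ρ ^ 2) (t' - κ * ρ ^ 2 / 2) ×ˢ closedBall x' (ρ / 4) ⊆
        Ioo (s - (2 * R) ^ 2) s ×ˢ ball y (2 * R) := by
      refine prod_mono (fun r₁ hr₁ => ⟨?_, ?_⟩) (closedBall_subset_ball' ?_)
      · have h1 := (htime (t' - κ * ρ ^ 2) ⟨le_rfl, by nlinarith⟩).1
        nlinarith [hr₁.1, ht.1, hr'R, hr'I.1]
      · have : 0 < κ * ρ ^ 2 := by positivity
        linarith [hr₁.2, ht'.2, ht.2]
      · have h1 : dist x' y ≤ dist x' x + dist x y := dist_triangle _ _ _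
        have h2 : ρ ≤ R := by rw [hρ_def]; linarith [hr'R]
        linarith
    have hsmall : ∫ p in Icc (t' - κ * ρ ^ 2) (t' - κ * ρ ^ 2 / 2) ×ˢ closedBall x' (ρ / 4), F p ≤
        I := setIntegral_mono_set hintQ (Eventually.of_forall hF0) hsub.eventuallyLE
    have hρeq : (ρ ^ (Module.finrank ℝ E + 2))⁻¹ =
        2 ^ (Module.finrank ℝ E + 2) / (r' - r) ^ (Module.finrank ℝ E + 2) := by
      rw [hρ_def, div_pow, inv_div]
    have hcoef : 0 ≤ 2 * c₀ / κ * (ρ ^ (Module.finrank ℝ E + 2))⁻¹ := by positivity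
    refine max_le ?_ hrhs0
    calc u t' x' ≤ θ₀ * f r' + 2 * c₀ / κ * (ρ ^ (Module.finrank ℝ E + 2))⁻¹ *
          ∫ p in Icc (t' - κ * ρ ^ 2) (t' - κ * ρ ^ 2 / 2) ×ˢ closedBall x' (ρ / 4), F p := hstep
      _ ≤ θ₀ * f r' + 2 * c₀ / κ * (ρ ^ (Module.finrank ℝ E + 2))⁻¹ * I := by
          linarith [mul_le_mul_of_nonneg_left hsmall hcoef]
      _ = θ₀ * f r' + C₁ * I / (r' - r) ^ (Module.finrank ℝ E + 2) := by
          rw [hρeq, hC₁]; ring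
  -- absorption
  have habs' := habs f 0 R (C₁ * I) (f R) hR (by positivity) hf0 hfmono
    (fun r r' h1 h2 h3 => hrec r r' h1 h2 h3)
  rw [sub_zero] at habs'
  have hux : u t x ≤ f 0 := (le_max_left _ _).trans (hFle 0 ⟨le_rfl, hR.le⟩ _ (hmemQ 0 le_rfl))
  have hkR : 0 ≤ k * R := by positivity
  calc u t x ≤ f 0 := hux
    _ ≤ Ca * (C₁ * I) / R ^ (Module.finrank ℝ E + 2) := habs'
    _ = Ca * C₁ * ((R ^ (Module.finrank ℝ E + 2))⁻¹ * I) := by ring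
    _ ≤ Ca * C₁ * ((R ^ (Module.finrank ℝ E + 2))⁻¹ * I + k * R) :=
        mul_le_mul_of_nonneg_left (by linarith) (by positivity)

end Solutions

end Literature.Analysis.FluidPDE

end
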